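import Summits.Ventures.DiscreteObjects.PP12.FanoFiveSignSystem

/-!
# PP(12), order 5: the PARITY LEMMA for designs g10's sign/Gram system (kernel) — all rows of `E` have the same weight parity
Framing: lottery ticket; floor = certified bounds/negative ranges.

Cell pub-namedobj (venture DiscreteObjects), target (M), designs gen 17; formalises designs g10 FAMILY-P5PLANE §4 ('skeleton lemma explaining
most of the emptiness') on the typed system `FanoFive.IsSignSystem I m E Es R` (`FanoFiveSignSystem`). Notation: `ndiff E O O'` = Hamming
distance of the rows `E_O, E_O'`; `wt E O` = number of `−1` entries; `ip R O O' = Σ_N R_{ON} R_{O'N}`; `sh R O O'` = number of common `1`-columns.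
* `inner_eq`: `⟨E_O, E_O'⟩ = 7 − 2·ndiff`; `ndiff_eq`: `ndiff = wt O + wt O' − 2·#(common −1)`; `ip_eq`: `ip = ndiff − 2` (`O ≠ O'`, from
  `2RRᵀ + EEᵀ = 24I + 3J`); `two_dvd_ip_sub_sh`: `ip ≡ sh (mod 2)` (entries `0,1,2`); `sum_sh_erase`: `Σ_{O' ≠ O} sh O O' = 2` (every column of
  `R` has exactly two `1`s, every row exactly two);
* **`wt_parity`**: all rows of `E` have the same weight parity — if both parity classes `A`, `B` were non-empty, `O ∈ A`, `O' ∈ B` would have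
  `ndiff` odd, hence `ip` odd, hence `sh ≥ 1`, so `|B| ≤ Σ_{O'≠O} sh = 2` and `|A| ≤ 2`, contradicting `|A| + |B| = 16`;
* consequences: `ip ∈ {0, 2, 4}`, `ndiff ∈ {2, 4, 6}`, `⟨E_O, E_O'⟩ ∈ {3, −1, −5}` (`O ≠ O'`), `sh ∈ {0, 2}`.
Pure finite combinatorics over `ℤ`; nothing here asserts any census statement. No `sorry`, no new axioms.
-/

namespace Summit.Ventures.DiscreteObjects.PP12

open Finset

namespace FanoFive

/-- Hamming distance of two rows of `E` -/
def ndiff (E : Fin 16 → Fin 7 → ℤ) (O O' : Fin 16) : ℕ := (univ.filter fun x => E O x ≠ E O' x).card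

/-- number of `−1` entries of a row of `E` -/
def wt (E : Fin 16 → Fin 7 → ℤ) (O : Fin 16) : ℕ := (univ.filter fun x => E O x = -1).card

/-- inner product of two rows of `R` -/
def ip (R : Fin 16 → Fin 16 → ℤ) (O O' : Fin 16) : ℤ := ∑ N, R O N * R O' N

/-- number of common `1`-columns of two rows of `R` -/
def sh (R : Fin 16 → Fin 16 → ℤ) (O O' : Fin 16) : ℕ := (univ.filter fun N => R O N = 1 ∧ R O' N = 1).card

namespace IsSignSystem

variable {I : Fin 7 → Fin 7 → Bool} {m : Fin 7 → Fin 7 → ℤ} {E Es : Fin 16 → Fin 7 → ℤ} {R : Fin 16 → Fin 16 → ℤ}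

/-- `⟨E_O, E_O'⟩ = 7 − 2·ndiff` -/
theorem inner_eq (h : IsSignSystem I m E Es R) (O O' : Fin 16) : ∑ x, E O x * E O' x = 7 - 2 * (ndiff E O O' : ℤ) := by
  have e : ∀ x, E O x * E O' x = 1 - 2 * (if E O x ≠ E O' x then 1 else 0 : ℤ) := by
    intro x
    rcases h.E_sign O x with h1 | h1 <;> rcases h.E_sign O' x with h2 | h2 <;> norm_num [h1, h2]
  rw [Finset.sum_congr rfl fun x _ => e x, Finset.sum_sub_distrib, ← Finset.mul_sum, Finset.sum_boole]
  simp [ndiff]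

/-- `ndiff = wt O + wt O' − 2·#(coordinates where both rows are −1)` -/
theorem ndiff_eq (h : IsSignSystem I m E Es R) (O O' : Fin 16) :
    (ndiff E O O' : ℤ) = wt E O + wt E O' - 2 * ((univ.filter fun x => E O x = -1 ∧ E O' x = -1).card : ℤ) := by
  have e : ∀ x, (if E O x ≠ E O' x then (1 : ℤ) else 0) =
      (if E O x = -1 then (1 : ℤ) else 0) + (if E O' x = -1 then (1 : ℤ) else 0) - 2 * (if E O x = -1 ∧ E O' x = -1 then (1 : ℤ) else 0) := by
    intro x
    rcases h.E_sign O x with h1 | h1 <;> rcases h.E_sign O' x with h2 | h2 <;> norm_num [h1, h2]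
  have s := Finset.sum_congr rfl fun x (_ : x ∈ (univ : Finset (Fin 7))) => e x
  rw [Finset.sum_sub_distrib, Finset.sum_add_distrib, ← Finset.mul_sum, Finset.sum_boole, Finset.sum_boole, Finset.sum_boole,
    Finset.sum_boole] at s
  simpa [ndiff, wt] using s

/-- `ip(O, O') = ndiff − 2` for `O ≠ O'` (from `2RRᵀ + EEᵀ = 24I + 3J`) -/
theorem ip_eq (h : IsSignSystem I m E Es R) {O O' : Fin 16} (hne : O ≠ O') : ip R O O' = (ndiff E O O' : ℤ) - 2 := by
  have hg := h.gram_R_rows O O'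
  rw [if_neg hne, inner_eq h] at hg
  unfold ip; linarith

/-- `ip ≥ 0` -/
theorem ip_nonneg (h : IsSignSystem I m E Es R) (O O' : Fin 16) : 0 ≤ ip R O O' := by
  unfold ip
  refine Finset.sum_nonneg fun N _ => mul_nonneg ?_ ?_
  · rcases h.R_range O N with h1 | h1 | h1 <;> rw [h1] <;> norm_num
  · rcases h.R_range O' N with h1 | h1 | h1 <;> rw [h1] <;> norm_num

/-- `ndiff ≤ 7` -/
theorem ndiff_le (E : Fin 16 → Fin 7 → ℤ) (O O' : Fin 16) : ndiff E O O' ≤ 7 := by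
  unfold ndiff
  exact (Finset.card_filter_le _ _).trans (by simp)

/-- `sh ≤ 2` (a row has only two `1`-columns) -/
theorem sh_le_two (h : IsSignSystem I m E Es R) (O O' : Fin 16) : sh R O O' ≤ 2 := by
  unfold sh
  rw [← (h.R_row_profile O).2]
  exact Finset.card_le_card fun N hN => by
    simp only [Finset.mem_filter, Finset.mem_univ, true_and] at hN ⊢
    exact hN.1

/-- `ip ≡ sh (mod 2)`: a product of two entries in `{0,1,2}` is odd iff both are `1` -/
theorem two_dvd_ip_sub_sh (h : IsSignSystem I m E Es R) (O O' : Fin 16) : (2 : ℤ) ∣ ip R O O' - sh R O O' := by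
  have hs : (sh R O O' : ℤ) = ∑ N, (if R O N = 1 ∧ R O' N = 1 then (1 : ℤ) else 0) := by
    rw [Finset.sum_boole]; rfl
  rw [hs, ip, ← Finset.sum_sub_distrib]
  refine Finset.dvd_sum fun N _ => ?_
  rcases h.R_range O N with h1 | h1 | h1 <;> rcases h.R_range O' N with h2 | h2 | h2 <;> norm_num [h1, h2]

/-- **`Σ_{O' ≠ O} sh(O, O') = 2`**: each of the two `1`-columns of `O` is a `1`-column of exactly one other row. -/
theorem sum_sh_erase (h : IsSignSystem I m E Es R) (O : Fin 16) : ∑ O' ∈ univ.erase O, (sh R O O' : ℤ) = 2 := by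
  have hs : ∀ O', (sh R O O' : ℤ) = ∑ N, (if R O N = 1 then (1 : ℤ) else 0) * (if R O' N = 1 then (1 : ℤ) else 0) := by
    intro O'
    have : (sh R O O' : ℤ) = ∑ N, (if R O N = 1 ∧ R O' N = 1 then (1 : ℤ) else 0) := by rw [Finset.sum_boole]; rfl
    rw [this]
    refine Finset.sum_congr rfl fun N _ => ?_
    by_cases h1 : R O N = 1 <;> by_cases h2 : R O' N = 1 <;> simp [h1, h2]
  simp_rw [hs]
  rw [Finset.sum_comm]
  have key : ∀ N, ∑ O' ∈ univ.erase O, (if R O N = 1 then (1 : ℤ) else 0) * (if R O' N = 1 then (1 : ℤ) else 0) =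
      if R O N = 1 then 1 else 0 := by
    intro N
    rw [← Finset.mul_sum]
    by_cases hN : R O N = 1
    · rw [if_pos hN, one_mul, Finset.sum_boole, Finset.filter_erase,
        Finset.card_erase_of_mem (by simp [hN]), (h.R_col_profile N).2]
      norm_num
    · rw [if_neg hN, zero_mul]
  rw [Finset.sum_congr rfl fun N _ => key N, Finset.sum_boole, (h.R_row_profile O).2]
  norm_num

/-- **PARITY LEMMA (FAMILY-P5PLANE §4): all rows of `E` have the same weight parity.** -/
theorem wt_parity (h : IsSignSystem I m E Es R) (O₁ O₂ : Fin 16) : (wt E O₁ : ℤ) % 2 = (wt E O₂ : ℤ) % 2 := by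
  by_contra hne
  -- the two parity classes
  set A : Finset (Fin 16) := univ.filter fun X => (wt E X : ℤ) % 2 = (wt E O₁ : ℤ) % 2 with hA
  set B : Finset (Fin 16) := univ.filter fun X => ¬ (wt E X : ℤ) % 2 = (wt E O₁ : ℤ) % 2 with hB
  have hAB : A.card + B.card = 16 := by
    rw [hA, hB, Finset.card_filter_add_card_filter_not]; simp
  have hO₁ : O₁ ∈ A := by simp [hA]
  have hO₂ : O₂ ∈ B := by simp [hB]; exact fun h' => hne h'.symm
  -- across the classes, `sh ≥ 1`
  have cross : ∀ X Y : Fin 16, (wt E X : ℤ) % 2 ≠ (wt E Y : ℤ) % 2 → 1 ≤ (sh R X Y : ℤ) := by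
    intro X Y hXY
    have hXY' : X ≠ Y := by rintro rfl; exact hXY rfl
    have h1 := ndiff_eq h X Y
    have h2 := ip_eq h hXY'
    have h3 := two_dvd_ip_sub_sh h X Y
    omega
  -- hence each class has at most two elements
  have bound : ∀ (X : Fin 16) (S : Finset (Fin 16)), (∀ Y ∈ S, (wt E X : ℤ) % 2 ≠ (wt E Y : ℤ) % 2) → (S.card : ℤ) ≤ 2 := by
    intro X S hS
    have hXS : X ∉ S := fun hX => hS X hX rfl
    calc (S.card : ℤ) = ∑ Y ∈ S, (1 : ℤ) := by simp
      _ ≤ ∑ Y ∈ S, (sh R X Y : ℤ) := Finset.sum_le_sum fun Y hY => cross X Y (hS Y hY)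
      _ ≤ ∑ Y ∈ univ.erase X, (sh R X Y : ℤ) :=
          Finset.sum_le_sum_of_subset_of_nonneg (fun Y hY => Finset.mem_erase.2 ⟨fun e => hXS (e ▸ hY), mem_univ Y⟩)
            fun Y _ _ => by positivity
      _ = 2 := sum_sh_erase h X
  have hBle : (B.card : ℤ) ≤ 2 := bound O₁ B fun Y hY => by
    simp only [hB, Finset.mem_filter, mem_univ, true_and] at hY
    exact fun e => hY e.symm
  have hAle : (A.card : ℤ) ≤ 2 := bound O₂ A fun Y hY => by
    simp only [hA, Finset.mem_filter, mem_univ, true_and] at hY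
    simp only [hB, Finset.mem_filter, mem_univ, true_and] at hO₂
    rw [hY]; exact hO₂
  omega

/-- hence all Hamming distances between rows of `E` are even … -/
theorem two_dvd_ndiff (h : IsSignSystem I m E Es R) (O O' : Fin 16) : (2 : ℤ) ∣ (ndiff E O O' : ℤ) := by
  have h1 := ndiff_eq h O O'
  have h2 := wt_parity h O O'
  omega

/-- … `ip(O, O')` is even for `O ≠ O'` … -/
theorem two_dvd_ip (h : IsSignSystem I m E Es R) {O O' : Fin 16} (hne : O ≠ O') : (2 : ℤ) ∣ ip R O O' := by
  have h1 := ip_eq h hne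
  have h2 := two_dvd_ndiff h O O'
  omega

/-- … so `ip(O, O') ∈ {0, 2, 4}` for `O ≠ O'` … -/
theorem ip_mem (h : IsSignSystem I m E Es R) {O O' : Fin 16} (hne : O ≠ O') : ip R O O' = 0 ∨ ip R O O' = 2 ∨ ip R O O' = 4 := by
  have h1 := ip_eq h hne
  have h2 := two_dvd_ip h hne
  have h3 := ip_nonneg h O O'
  have h4 := ndiff_le E O O'
  omega

/-- … the Hamming distances are `2, 4, 6` … -/
theorem ndiff_mem (h : IsSignSystem I m E Es R) {O O' : Fin 16} (hne : O ≠ O') : ndiff E O O' = 2 ∨ ndiff E O O' = 4 ∨ ndiff E O O' = 6 := by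
  have h1 := ip_eq h hne
  have h2 := ip_mem h hne
  omega

/-- … the inner products of distinct rows of `E` are `3, −1, −5` … -/
theorem inner_mem (h : IsSignSystem I m E Es R) {O O' : Fin 16} (hne : O ≠ O') :
    ∑ x, E O x * E O' x = 3 ∨ ∑ x, E O x * E O' x = -1 ∨ ∑ x, E O x * E O' x = -5 := by
  have h1 := inner_eq h O O'
  have h2 := ndiff_mem h hne
  omega

/-- … and two rows of `R` share `0` or `2` one-columns. -/
theorem sh_mem (h : IsSignSystem I m E Es R) {O O' : Fin 16} (hne : O ≠ O') : sh R O O' = 0 ∨ sh R O O' = 2 := by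
  have h1 := two_dvd_ip h hne
  have h2 := two_dvd_ip_sub_sh h O O'
  have h3 := sh_le_two h O O'
  omega

end IsSignSystem

end FanoFive

end Summit.Ventures.DiscreteObjects.PP12
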